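import Summits.AtomisticToContinuum.Crystallization.Theses.ReggeStarCoercivity
import Summits.AtomisticToContinuum.Crystallization.Theorems.ReggeStarCoercivityDefectFreeCrystallizesPalmDefs
import Summits.AtomisticToContinuum.Crystallization.Theorems.PalmUnimodularRigidityLayeredLawsSelectHcpDefs
import Literature.Probability.Process.PointStationaryLaw
import Literature.MathematicalPhysics.StatisticalMechanics.BarlowStacking
import Literature.Geometry.DiscreteGeometry.KissingPatterns
import Summits.AtomisticToContinuum.Crystallization.Theorems.ReggeStarCoercivityDefectFreeCrystallizesExactFrameHB
import Summits.AtomisticToContinuum.Crystallization.Theorems.ReggeStarCoercivityDefectFreeCrystallizesExactFrameCB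
import Summits.AtomisticToContinuum.Crystallization.Theorems.ReggeStarCoercivityDefectFreeCrystallizesFramePropagation
import Summits.AtomisticToContinuum.Crystallization.Theorems.ReggeStarCoercivityDefectFreeCrystallizesExactStarShortcutRigidity

/-!
# The exact-star shortcut, first-shell form, I: X2B `stub_exactStarRigidityB` (line `palm-good-law`, lead c10, skeleton v33;
# item stmt-AtomisticToContinuum-13603)

The landed X2 `ExactStarShortcutRigidity.stub_exactStarRigidity` (p162052: exact stars everywhere on a charted set ⇒ an exact rotated
Barlow stacking) asks, at every point, that the annulus `{11/10 < ‖y‖ ≤ 5/4}` of the re-rooted configuration be empty.  Its proof (through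
X2a `ExactFrameH.rootStar_eq` and X2b `ExactFrameC.rootStar_eqC`) uses this only on `(11/10, 6/5)`: a chart contact, at distance `< 6/5`,
must lie in `rootStar` (radius `11/10`).  The part `[6/5, 5/4]` is second-shell content.  This file re-assembles X2 in FIRST-SHELL FORM —
guard `{11/10 < ‖y‖ < 6/5} = 0`, i.e. "no thirteenth atom inside the bond radius" — from the re-landed X2aB `ExactFrameHB.stub_exactFrameHB`
(p167496) and X2bB `ExactFrameCB.stub_exactFrameCB` (p167653) and the guard-free X2c `FramePropagation.stub_framePropagation` (p159157); the
glue `exactStarRigidityB_of_frames` is the landed `exactStarRigidity_of_frames` verbatim up to the guard constant (re-root the ideal stacking at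
the label of `0` by a WORD SHIFT, `ExactStarShortcutRigidity.barlowPos_add_shift`; index the set; read local frames; propagate).  Purpose: the
registered residue of crux 13603 (`stub_funnelEquality`, GROUND-STATE FUNNEL EQUALITY) can then be stated with the weaker first-shell guard
(part II, `…ExactStarShortcutFirstShell`).  All `[folklore]`.
-/

noncomputable section

open scoped BigOperators ENNReal
open Filter Topology MeasureTheory

namespace Summit.AtomisticToContinuum.Crystallization.Theorems.PalmGoodLaw.ExactStarShortcutRigidityB

open Literature.MathematicalPhysics.StatisticalMechanics Literature.Geometry.DiscreteGeometry
open Literature.Probability.Process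
open Summit.AtomisticToContinuum.Crystallization.Theorems.PalmGoodLaw (SetGood)
open Summit.AtomisticToContinuum.Crystallization.Theorems.PalmUnimodularRigidity.LayeredLawsSelectHcp
  (rootStar starDefect)

/-- **X2B ⇐ X2aB + X2bB + X2c (sorry-free glue, lead c10 — the landed `ExactStarShortcutRigidity.exactStarRigidity_of_frames` VERBATIM up to
the guard constant).**  From the chart `Φ` of `S ∋ 0`, re-root the ideal stacking at the label of `0` (`barlowPos_add_shift`), index `S` by
`X`, read the local frames from X2aB/X2bB and propagate them with X2c. [folklore] -/
theorem exactStarRigidityB_of_frames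
    (hH :
        ∀ a₀ h₀ : ℝ, 189 / 200 ≤ a₀ → a₀ ≤ 199 / 200 → 77 / 100 ≤ h₀ → h₀ ≤ 163 / 200 →
          ∀ s : ℤ → ℤ, IsHaggSeq s →
          ∀ X : ℤ × ℤ × ℤ → EuclideanSpace ℝ (Fin 3), Function.Injective X →
            (∀ u w : ℤ × ℤ × ℤ,
              dist (barlowPos 1 (Real.sqrt (2 / 3)) s u.1 u.2.1 u.2.2) (barlowPos 1 (Real.sqrt (2 / 3)) s w.1 w.2.1 w.2.2) = 1 ↔
                (0 < dist (X u) (X w) ∧ dist (X u) (X w) < 6 / 5)) →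
            ∀ u : ℤ × ℤ × ℤ, s (u.1 - 1) ≠ s u.1 →
              (Summit.AtomisticToContinuum.Crystallization.Theorems.PalmUnimodularRigidity.LayeredLawsSelectHcp.starDefect a₀ h₀
                  ((Measure.count : Measure (EuclideanSpace ℝ (Fin 3))).restrict
                    ((fun z : EuclideanSpace ℝ (Fin 3) => z - X u) '' Set.range X)) = 0 ∨
                (⨅ A : EuclideanSpace ℝ (Fin 3) ≃ₗᵢ[ℝ] EuclideanSpace ℝ (Fin 3),
                  ∑ p ∈ fccKissingPattern, Metric.infDist (A (a₀ • p))
                    (Summit.AtomisticToContinuum.Crystallization.Theorems.PalmUnimodularRigidity.LayeredLawsSelectHcp.rootStar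
                      ((Measure.count : Measure (EuclideanSpace ℝ (Fin 3))).restrict
                        ((fun z : EuclideanSpace ℝ (Fin 3) => z - X u) '' Set.range X))) ^ 2) = 0) →
              (Measure.count : Measure (EuclideanSpace ℝ (Fin 3))).restrict
                  ((fun z : EuclideanSpace ℝ (Fin 3) => z - X u) '' Set.range X)
                  {y : EuclideanSpace ℝ (Fin 3) | 11 / 10 < ‖y‖ ∧ ‖y‖ < 6 / 5} = 0 →
              ∃ A : EuclideanSpace ℝ (Fin 3) ≃ₗᵢ[ℝ] EuclideanSpace ℝ (Fin 3), ∀ w : ℤ × ℤ × ℤ,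
                dist (barlowPos 1 (Real.sqrt (2 / 3)) s u.1 u.2.1 u.2.2) (barlowPos 1 (Real.sqrt (2 / 3)) s w.1 w.2.1 w.2.2) = 1 →
                X w - X u = A (barlowPos a₀ h₀ s w.1 w.2.1 w.2.2 - barlowPos a₀ h₀ s u.1 u.2.1 u.2.2))
    (hC :
        ∀ a₀ h₀ : ℝ, 189 / 200 ≤ a₀ → a₀ ≤ 199 / 200 → 77 / 100 ≤ h₀ → h₀ ≤ 163 / 200 →
          ∀ s : ℤ → ℤ, IsHaggSeq s →
          ∀ X : ℤ × ℤ × ℤ → EuclideanSpace ℝ (Fin 3), Function.Injective X →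
            (∀ u w : ℤ × ℤ × ℤ,
              dist (barlowPos 1 (Real.sqrt (2 / 3)) s u.1 u.2.1 u.2.2) (barlowPos 1 (Real.sqrt (2 / 3)) s w.1 w.2.1 w.2.2) = 1 ↔
                (0 < dist (X u) (X w) ∧ dist (X u) (X w) < 6 / 5)) →
            ∀ u : ℤ × ℤ × ℤ, s (u.1 - 1) = s u.1 →
              (Summit.AtomisticToContinuum.Crystallization.Theorems.PalmUnimodularRigidity.LayeredLawsSelectHcp.starDefect a₀ h₀
                  ((Measure.count : Measure (EuclideanSpace ℝ (Fin 3))).restrict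
                    ((fun z : EuclideanSpace ℝ (Fin 3) => z - X u) '' Set.range X)) = 0 ∨
                (⨅ A : EuclideanSpace ℝ (Fin 3) ≃ₗᵢ[ℝ] EuclideanSpace ℝ (Fin 3),
                  ∑ p ∈ fccKissingPattern, Metric.infDist (A (a₀ • p))
                    (Summit.AtomisticToContinuum.Crystallization.Theorems.PalmUnimodularRigidity.LayeredLawsSelectHcp.rootStar
                      ((Measure.count : Measure (EuclideanSpace ℝ (Fin 3))).restrict
                        ((fun z : EuclideanSpace ℝ (Fin 3) => z - X u) '' Set.range X))) ^ 2) = 0) →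
              (Measure.count : Measure (EuclideanSpace ℝ (Fin 3))).restrict
                  ((fun z : EuclideanSpace ℝ (Fin 3) => z - X u) '' Set.range X)
                  {y : EuclideanSpace ℝ (Fin 3) | 11 / 10 < ‖y‖ ∧ ‖y‖ < 6 / 5} = 0 →
              ∃ A : EuclideanSpace ℝ (Fin 3) ≃ₗᵢ[ℝ] EuclideanSpace ℝ (Fin 3), ∀ w : ℤ × ℤ × ℤ,
                dist (barlowPos 1 (Real.sqrt (2 / 3)) s u.1 u.2.1 u.2.2) (barlowPos 1 (Real.sqrt (2 / 3)) s w.1 w.2.1 w.2.2) = 1 →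
                X w - X u = A (barlowPos a₀ (a₀ * Real.sqrt (2 / 3)) s w.1 w.2.1 w.2.2 -
                  barlowPos a₀ (a₀ * Real.sqrt (2 / 3)) s u.1 u.2.1 u.2.2))
    (hP : ∀ a₀ h₀ : ℝ, 189 / 200 ≤ a₀ → a₀ ≤ 199 / 200 → 77 / 100 ≤ h₀ → h₀ ≤ 163 / 200 →
      ∀ s : ℤ → ℤ, IsHaggSeq s →
      ∀ X : ℤ × ℤ × ℤ → EuclideanSpace ℝ (Fin 3), X (0, 0, 0) = 0 →
        (∀ u : ℤ × ℤ × ℤ, s (u.1 - 1) ≠ s u.1 →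
          ∃ A : EuclideanSpace ℝ (Fin 3) ≃ₗᵢ[ℝ] EuclideanSpace ℝ (Fin 3), ∀ w : ℤ × ℤ × ℤ,
            dist (barlowPos 1 (Real.sqrt (2 / 3)) s u.1 u.2.1 u.2.2) (barlowPos 1 (Real.sqrt (2 / 3)) s w.1 w.2.1 w.2.2) = 1 →
            X w - X u = A (barlowPos a₀ h₀ s w.1 w.2.1 w.2.2 - barlowPos a₀ h₀ s u.1 u.2.1 u.2.2)) →
        (∀ u : ℤ × ℤ × ℤ, s (u.1 - 1) = s u.1 →
          ∃ A : EuclideanSpace ℝ (Fin 3) ≃ₗᵢ[ℝ] EuclideanSpace ℝ (Fin 3), ∀ w : ℤ × ℤ × ℤ,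
            dist (barlowPos 1 (Real.sqrt (2 / 3)) s u.1 u.2.1 u.2.2) (barlowPos 1 (Real.sqrt (2 / 3)) s w.1 w.2.1 w.2.2) = 1 →
            X w - X u = A (barlowPos a₀ (a₀ * Real.sqrt (2 / 3)) s w.1 w.2.1 w.2.2 -
              barlowPos a₀ (a₀ * Real.sqrt (2 / 3)) s u.1 u.2.1 u.2.2)) →
        ∃ h : ℝ, (h = h₀ ∨ h = a₀ * Real.sqrt (2 / 3)) ∧
          ∃ A : EuclideanSpace ℝ (Fin 3) ≃ₗᵢ[ℝ] EuclideanSpace ℝ (Fin 3), ∀ u : ℤ × ℤ × ℤ,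
            X u = A (barlowPos a₀ h s u.1 u.2.1 u.2.2)) :
      ∀ a₀ h₀ : ℝ, 189 / 200 ≤ a₀ → a₀ ≤ 199 / 200 → 77 / 100 ≤ h₀ → h₀ ≤ 163 / 200 →
        ∀ S : Set (EuclideanSpace ℝ (Fin 3)), (0 : EuclideanSpace ℝ (Fin 3)) ∈ S →
          (∀ y ∈ S, SetGood S y) →
          (∃ s : ℤ → ℤ, IsHaggSeq s ∧
            ∃ Φ : EuclideanSpace ℝ (Fin 3) → EuclideanSpace ℝ (Fin 3),
              Set.BijOn Φ (barlowStacking 1 (Real.sqrt (2 / 3)) s) S ∧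
              ∀ p ∈ barlowStacking 1 (Real.sqrt (2 / 3)) s, ∀ q ∈ barlowStacking 1 (Real.sqrt (2 / 3)) s,
                (dist p q = 1 ↔ (0 < dist (Φ p) (Φ q) ∧ dist (Φ p) (Φ q) < 6 / 5))) →
          (∀ x ∈ S,
            (Summit.AtomisticToContinuum.Crystallization.Theorems.PalmUnimodularRigidity.LayeredLawsSelectHcp.starDefect a₀ h₀
                ((Measure.count : Measure (EuclideanSpace ℝ (Fin 3))).restrict ((fun z : EuclideanSpace ℝ (Fin 3) => z - x) '' S)) = 0 ∨
              (⨅ A : EuclideanSpace ℝ (Fin 3) ≃ₗᵢ[ℝ] EuclideanSpace ℝ (Fin 3),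
                ∑ p ∈ fccKissingPattern, Metric.infDist (A (a₀ • p))
                  (Summit.AtomisticToContinuum.Crystallization.Theorems.PalmUnimodularRigidity.LayeredLawsSelectHcp.rootStar
                    ((Measure.count : Measure (EuclideanSpace ℝ (Fin 3))).restrict ((fun z : EuclideanSpace ℝ (Fin 3) => z - x) '' S))) ^ 2) = 0) ∧
            (Measure.count : Measure (EuclideanSpace ℝ (Fin 3))).restrict ((fun z : EuclideanSpace ℝ (Fin 3) => z - x) '' S)
              {y : EuclideanSpace ℝ (Fin 3) | 11 / 10 < ‖y‖ ∧ ‖y‖ < 6 / 5} = 0) →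
          ∃ A : EuclideanSpace ℝ (Fin 3) ≃ₗᵢ[ℝ] EuclideanSpace ℝ (Fin 3), ∃ h : ℝ, (h = h₀ ∨ h = a₀ * Real.sqrt (2 / 3)) ∧
            ∃ s' : ℤ → ℤ, IsHaggSeq s' ∧ S = A '' barlowStacking a₀ h s' := by
  intro a₀ h₀ ha₁ ha₂ hh₁ hh₂ S h0S _hgood hchart hx
  obtain ⟨s, hs, Φ, hΦ, hbond⟩ := hchart
  -- the label of the root
  obtain ⟨p₀, hp₀, hΦp₀⟩ := hΦ.surjOn h0S
  obtain ⟨k₀, i₀, j₀, rfl⟩ := hp₀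
  -- the shifted word and the indexation `X`
  set r : ℝ := Real.sqrt (2 / 3) with hr
  set s' : ℤ → ℤ := fun m => s (m + k₀) with hs'_def
  have hs' : IsHaggSeq s' := fun i => hs (i + k₀)
  set X : ℤ × ℤ × ℤ → (EuclideanSpace ℝ (Fin 3)) := fun u => Φ (barlowPos 1 r s (u.1 + k₀) (u.2.1 + i₀) (u.2.2 + j₀)) with hX_def
  have hsite : ∀ u : ℤ × ℤ × ℤ, barlowPos 1 r s (u.1 + k₀) (u.2.1 + i₀) (u.2.2 + j₀) =
      barlowPos 1 r s k₀ i₀ j₀ + barlowPos 1 r s' u.1 u.2.1 u.2.2 := fun u =>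
    Summit.AtomisticToContinuum.Crystallization.Theorems.PalmGoodLaw.ExactStarShortcutRigidity.barlowPos_add_shift 1 r s k₀ i₀ j₀ u.1 u.2.1 u.2.2
  have hmem : ∀ u : ℤ × ℤ × ℤ, barlowPos 1 r s (u.1 + k₀) (u.2.1 + i₀) (u.2.2 + j₀) ∈ barlowStacking 1 r s :=
    fun u => barlowPos_mem _ _ _
  have hmem' : ∀ u : ℤ × ℤ × ℤ, barlowPos 1 r s k₀ i₀ j₀ + barlowPos 1 r s' u.1 u.2.1 u.2.2 ∈ barlowStacking 1 r s :=
    fun u => hsite u ▸ hmem u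
  have hXu : ∀ u : ℤ × ℤ × ℤ, X u = Φ (barlowPos 1 r s k₀ i₀ j₀ + barlowPos 1 r s' u.1 u.2.1 u.2.2) := fun u => by
    simp only [hX_def, hsite]
  have hX0 : X (0, 0, 0) = 0 := by
    simp only [hX_def, zero_add]
    exact hΦp₀
  -- `X` is injective
  have hXinj : Function.Injective X := by
    intro u w huw
    have h1 := hΦ.injOn (hmem u) (hmem w) huw
    have hr0 : (0 : ℝ) < r := Real.sqrt_pos.2 (by norm_num)
    have h2 := Summit.AtomisticToContinuum.Crystallization.Theorems.barlowPos_injective one_pos hr0 s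
      (a₁ := (u.1 + k₀, u.2.1 + i₀, u.2.2 + j₀)) (a₂ := (w.1 + k₀, w.2.1 + i₀, w.2.2 + j₀)) h1
    simp only [Prod.mk.injEq, add_left_inj] at h2
    exact Prod.ext h2.1 (Prod.ext h2.2.1 h2.2.2)
  -- `X` is onto `S`
  have hrange : Set.range X = S := by
    apply Set.Subset.antisymm
    · rintro y ⟨u, rfl⟩
      exact hΦ.mapsTo (hmem u)
    · intro y hy
      obtain ⟨p, hp, rfl⟩ := hΦ.surjOn hy
      obtain ⟨k, i, j, rfl⟩ := hp
      refine ⟨(k - k₀, i - i₀, j - j₀), ?_⟩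
      simp only [hX_def, sub_add_cancel]
  -- `X` is charted for the shifted word
  have hchartX : ∀ u w : ℤ × ℤ × ℤ,
      dist (barlowPos 1 r s' u.1 u.2.1 u.2.2) (barlowPos 1 r s' w.1 w.2.1 w.2.2) = 1 ↔
        (0 < dist (X u) (X w) ∧ dist (X u) (X w) < 6 / 5) := by
    intro u w
    have h1 := hbond _ (hmem' u) _ (hmem' w)
    rw [dist_add_left] at h1
    rw [hXu u, hXu w]
    exact h1
  -- exact stars and no thirteenth atom inside the bond radius at every `X u`
  have hxX : ∀ u : ℤ × ℤ × ℤ,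
      (starDefect a₀ h₀
          ((Measure.count : Measure (EuclideanSpace ℝ (Fin 3))).restrict ((fun z : (EuclideanSpace ℝ (Fin 3)) => z - X u) '' Set.range X)) = 0 ∨
        (⨅ A : (EuclideanSpace ℝ (Fin 3)) ≃ₗᵢ[ℝ] (EuclideanSpace ℝ (Fin 3)), ∑ p ∈ fccKissingPattern, Metric.infDist (A (a₀ • p))
          (rootStar ((Measure.count : Measure (EuclideanSpace ℝ (Fin 3))).restrict ((fun z : (EuclideanSpace ℝ (Fin 3)) => z - X u) '' Set.range X))) ^ 2) = 0) ∧
      (Measure.count : Measure (EuclideanSpace ℝ (Fin 3))).restrict ((fun z : (EuclideanSpace ℝ (Fin 3)) => z - X u) '' Set.range X)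
        {y : (EuclideanSpace ℝ (Fin 3)) | 11 / 10 < ‖y‖ ∧ ‖y‖ < 6 / 5} = 0 := by
    intro u
    rw [hrange]
    exact hx (X u) (hrange ▸ Set.mem_range_self u)
  -- local frames (X2aB at `h`-type sites, X2bB at `c`-type sites)
  have hframeH : ∀ u : ℤ × ℤ × ℤ, s' (u.1 - 1) ≠ s' u.1 →
      ∃ A : (EuclideanSpace ℝ (Fin 3)) ≃ₗᵢ[ℝ] (EuclideanSpace ℝ (Fin 3)), ∀ w : ℤ × ℤ × ℤ,
        dist (barlowPos 1 r s' u.1 u.2.1 u.2.2) (barlowPos 1 r s' w.1 w.2.1 w.2.2) = 1 →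
        X w - X u = A (barlowPos a₀ h₀ s' w.1 w.2.1 w.2.2 - barlowPos a₀ h₀ s' u.1 u.2.1 u.2.2) :=
    fun u hu => hH a₀ h₀ ha₁ ha₂ hh₁ hh₂ s' hs' X hXinj hchartX u hu (hxX u).1 (hxX u).2
  have hframeC : ∀ u : ℤ × ℤ × ℤ, s' (u.1 - 1) = s' u.1 →
      ∃ A : (EuclideanSpace ℝ (Fin 3)) ≃ₗᵢ[ℝ] (EuclideanSpace ℝ (Fin 3)), ∀ w : ℤ × ℤ × ℤ,
        dist (barlowPos 1 r s' u.1 u.2.1 u.2.2) (barlowPos 1 r s' w.1 w.2.1 w.2.2) = 1 →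
        X w - X u = A (barlowPos a₀ (a₀ * Real.sqrt (2 / 3)) s' w.1 w.2.1 w.2.2 -
          barlowPos a₀ (a₀ * Real.sqrt (2 / 3)) s' u.1 u.2.1 u.2.2) :=
    fun u hu => hC a₀ h₀ ha₁ ha₂ hh₁ hh₂ s' hs' X hXinj hchartX u hu (hxX u).1 (hxX u).2
  -- propagation (X2c)
  obtain ⟨h, hh, A, hA⟩ := hP a₀ h₀ ha₁ ha₂ hh₁ hh₂ s' hs' X hX0 hframeH hframeC
  refine ⟨A, h, hh, s', hs', ?_⟩
  rw [← hrange]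
  ext y
  simp only [Set.mem_range, Set.mem_image, mem_barlowStacking_iff]
  constructor
  · rintro ⟨u, rfl⟩
    exact ⟨barlowPos a₀ h s' u.1 u.2.1 u.2.2, ⟨u.1, u.2.1, u.2.2, rfl⟩, (hA u).symm⟩
  · rintro ⟨p, ⟨k, i, j, rfl⟩, rfl⟩
    exact ⟨(k, i, j), hA (k, i, j)⟩

/-- **X2B `stub_exactStarRigidityB` (lead c10; anchor of this file — sorry-free glue over the landed X2aB `ExactFrameHB.stub_exactFrameHB` (p167496), X2bB `ExactFrameCB.stub_exactFrameCB` (p167653) and X2c `FramePropagation.stub_framePropagation` (p159157)).**  EXACT STARS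
EVERYWHERE ⇒ AN EXACT STACKING, first-shell form: an everywhere-`SetGood` Barlow-charted set containing `0` all of whose re-rooted stars are
exact (relaxed-hcp OR fcc type, no thirteenth atom inside the bond radius `6/5`) is `A '' barlowStacking a₀ h s'` with `h ∈ {h₀, a₀√(2/3)}`. [folklore] -/
theorem stub_exactStarRigidityB :
    ∀ a₀ h₀ : ℝ, 189 / 200 ≤ a₀ → a₀ ≤ 199 / 200 → 77 / 100 ≤ h₀ → h₀ ≤ 163 / 200 →
      ∀ S : Set (EuclideanSpace ℝ (Fin 3)), (0 : EuclideanSpace ℝ (Fin 3)) ∈ S →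
        (∀ y ∈ S, SetGood S y) →
        (∃ s : ℤ → ℤ, IsHaggSeq s ∧
          ∃ Φ : EuclideanSpace ℝ (Fin 3) → EuclideanSpace ℝ (Fin 3),
            Set.BijOn Φ (barlowStacking 1 (Real.sqrt (2 / 3)) s) S ∧
            ∀ p ∈ barlowStacking 1 (Real.sqrt (2 / 3)) s, ∀ q ∈ barlowStacking 1 (Real.sqrt (2 / 3)) s,
              (dist p q = 1 ↔ (0 < dist (Φ p) (Φ q) ∧ dist (Φ p) (Φ q) < 6 / 5))) →
        (∀ x ∈ S,
          (Summit.AtomisticToContinuum.Crystallization.Theorems.PalmUnimodularRigidity.LayeredLawsSelectHcp.starDefect a₀ h₀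
              ((Measure.count : Measure (EuclideanSpace ℝ (Fin 3))).restrict ((fun z : EuclideanSpace ℝ (Fin 3) => z - x) '' S)) = 0 ∨
            (⨅ A : EuclideanSpace ℝ (Fin 3) ≃ₗᵢ[ℝ] EuclideanSpace ℝ (Fin 3),
              ∑ p ∈ fccKissingPattern, Metric.infDist (A (a₀ • p))
                (Summit.AtomisticToContinuum.Crystallization.Theorems.PalmUnimodularRigidity.LayeredLawsSelectHcp.rootStar
                  ((Measure.count : Measure (EuclideanSpace ℝ (Fin 3))).restrict ((fun z : EuclideanSpace ℝ (Fin 3) => z - x) '' S))) ^ 2) = 0) ∧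
          (Measure.count : Measure (EuclideanSpace ℝ (Fin 3))).restrict ((fun z : EuclideanSpace ℝ (Fin 3) => z - x) '' S)
            {y : EuclideanSpace ℝ (Fin 3) | 11 / 10 < ‖y‖ ∧ ‖y‖ < 6 / 5} = 0) →
        ∃ A : EuclideanSpace ℝ (Fin 3) ≃ₗᵢ[ℝ] EuclideanSpace ℝ (Fin 3), ∃ h : ℝ, (h = h₀ ∨ h = a₀ * Real.sqrt (2 / 3)) ∧
          ∃ s' : ℤ → ℤ, IsHaggSeq s' ∧ S = A '' barlowStacking a₀ h s' :=
  exactStarRigidityB_of_frames ExactFrameHB.stub_exactFrameHB ExactFrameCB.stub_exactFrameCB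
    FramePropagation.stub_framePropagation

end Summit.AtomisticToContinuum.Crystallization.Theorems.PalmGoodLaw.ExactStarShortcutRigidityB

end
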